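import Summits.QuantumFields.YangMills.Theorems.ColdStartUniversalityLatticeLangevinWilsonLogSobolev
import Summits.QuantumFields.YangMills.Theorems.ColdStartUniversalityLatticeLangevinWilsonLogSobolevPoincare
import Summits.QuantumFields.YangMills.Theorems.ColdStartUniversalityLatticeLangevinWilsonGapUpperBound
import HarnessLib

/-!
# Route `ColdStartUniversality`, aside K_A1 `UniformColdStartMixing` (24809), LINE 4 «cold_entropy» — the FIXED-CUT-OFF RUNG OF (ULS)
# WITH ITS CONSTANT: at cut-off `K` the log-Sobolev constant of `μ_K` in lattice units lies in `[(1/2)e^{−4|β'_K|#𝒫_K}, 3/4]`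

Helper file (seat `ym-line-csu-p1`, g22; `--supports stmt-QuantumFields-24809`).  (ULS) — the named input of the registered XL stub
`stub_entropyDissipation` (`stub_entropyDissipation_of_uniformLogSobolev`, g21) — asks for a generator-form log-Sobolev inequality
`c·ε_K·Ent_{μ_K}(F²) ≤ −∫ F 𝓛_K f dμ_K` on `C³` cylinders with `c > 0` INDEPENDENT of the cut-off `K` (`μ_K` the Wilson measure at the SZZ
coupling `β'_K = (γε_K)⁻¹/2` on the lattice `L_K = (F.P K).sitesPerDir 0`).  With g22's explicit package this rung is now a NUMBER at each `K`:

* ★ `uniformLogSobolev_fixedCutoff_explicit` — the (ULS) inequality at cut-off `K` with `c_K := (1/2)e^{−|β'_K|·4·#𝒫_K}/ε_K`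
  (`wilson_generatorLogSobolev_explicit`);
* ★ `logSobolev_const_le_three_quarters` — conversely (`L ≥ 2`, any `β'`), EVERY generator-form log-Sobolev constant of `μ_{β'}` is
  `≤ 3/4` in lattice units (LS(ρ) ⇒ P(2ρ), g21, and the gauge modes `generatorPoincare_const_le_three_halves`, g19);
* ★ `physicalLogSobolevRate_le_fixedCutoff` — hence no physical constant `c` of (ULS) at cut-off `K` exceeds `3/(4ε_K)` (no obstruction).

PLANNER-FACING, HONEST: `c_K ~ ε_K⁻¹ exp(−6L_K³/(γε_K)) → 0` super-exponentially — the generic (Holley–Stroock) fixed-cut-off constant is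
hopeless for (ULS), whose content is precisely a K-UNIFORM `c`; this is the entropy twin of g19's `uniformL2Gap_fixedCutoff_explicit`.
RECORD-rung R3 plumbing; 24809 is ASIDE and NOT restated; nothing K-uniform is proved; no crux, rung of the ladder or summit statement is
proved; the Yang–Mills mass gap is NOT proved.
-/

set_option autoImplicit false

noncomputable section

namespace Summit.QuantumFields.YangMills.Theorems.ColdStartUniversality

open MeasureTheory ProbabilityTheory
open scoped NNReal ENNReal BigOperators
open Literature.Probability.Process Literature.MathematicalPhysics.QuantumFieldTheory
open Literature.MathematicalPhysics.QuantumLattice (fundamentalRep fundamentalLatticeRep continuous_fundamentalRep)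
open Literature.MathematicalPhysics.QuantumFieldTheory.Balaban1983to89

/-- ★ **Every generator-form log-Sobolev constant of `μ_{β'}` is `≤ 3/4`** (`L ≥ 2`, every `β'`): if `ρ Ent_μ(F²) ≤ −∫ F 𝓛_{β'}f dμ_{β'}`
for every `C³` cylinder, then `ρ ≤ 3/4` (`generatorPoincare_of_generatorLogSobolev`: LS(ρ) ⇒ P(2ρ); `generatorPoincare_const_le_three_halves`:
every Poincaré constant is `≤ 3/2`).  With `wilson_generatorLogSobolev_explicit`: the optimal constant lies in `[(1/2)e^{−4|β'|#𝒫}, 3/4]`.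
[cite: BakryGentilLedoux2014, Prop. 5.1.3] -/
theorem logSobolev_const_le_three_quarters (L : ℕ) [NeZero L] (hL : 2 ≤ L) (β' : ℝ) {ρ : ℝ}
    (hLSgen : ∀ (f : (Edge 3 L × Fin 2 × Fin 2 × Bool → ℝ) → ℝ), ContDiff ℝ 3 f →
        let coords : GaugeConfig 3 L (Matrix.specialUnitaryGroup (Fin 2) ℂ) → (Edge 3 L × Fin 2 × Fin 2 × Bool → ℝ) :=
          fun V q => (fun z : ℂ => if q.2.2.2 then z.im else z.re)
            ((fundamentalRep (Fin 2) (V q.1) : Matrix (Fin 2) (Fin 2) ℂ) q.2.1 q.2.2.1)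
        let gen : GaugeConfig 3 L (Matrix.specialUnitaryGroup (Fin 2) ℂ) → ℝ := fun V =>
          (∑ i : Edge 3 L × Fin 2 × Fin 2 × Bool, fderiv ℝ f (coords V) (Pi.single i 1) *
              (fun z : ℂ => if i.2.2.2 then z.im else z.re)
                ((latticeLangevinDynamics (fundamentalLatticeRep 2) β').drift
                  (matrixConfig (fundamentalRep (Fin 2)) V) i.1 i.2.1 i.2.2.1) +
          1 / 2 * ∑ i : Edge 3 L × Fin 2 × Fin 2 × Bool, ∑ j : Edge 3 L × Fin 2 × Fin 2 × Bool,
            fderiv ℝ (fun z => fderiv ℝ f z (Pi.single i 1)) (coords V) (Pi.single j 1) *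
              ∑ n : Edge 3 L × NoiseIdx 2,
                (if n.1 = i.1 then (fun z : ℂ => if i.2.2.2 then z.im else z.re)
                  ((latticeLangevinDynamics (fundamentalLatticeRep 2) β').noise
                    (matrixConfig (fundamentalRep (Fin 2)) V) i.1 n.2 i.2.1 i.2.2.1) else 0) *
                (if n.1 = j.1 then (fun z : ℂ => if j.2.2.2 then z.im else z.re)
                  ((latticeLangevinDynamics (fundamentalLatticeRep 2) β').noise
                    (matrixConfig (fundamentalRep (Fin 2)) V) j.1 n.2 j.2.1 j.2.2.1) else 0))
        ρ * ((∫ V, f (coords V) ^ 2 * Real.log (f (coords V) ^ 2) ∂(wilsonMeasure (d := 3) (L := L) (fundamentalRep (Fin 2)) β')) -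
            (∫ V, f (coords V) ^ 2 ∂(wilsonMeasure (d := 3) (L := L) (fundamentalRep (Fin 2)) β')) *
              Real.log (∫ V, f (coords V) ^ 2 ∂(wilsonMeasure (d := 3) (L := L) (fundamentalRep (Fin 2)) β'))) ≤
          -∫ V, f (coords V) * gen V ∂(wilsonMeasure (d := 3) (L := L) (fundamentalRep (Fin 2)) β')) :
    ρ ≤ 3 / 4 := by
  have h := generatorPoincare_const_le_three_halves L hL β' (lam := 2 * ρ)
    (fun f hf => generatorPoincare_of_generatorLogSobolev L β' hLSgen f hf)
  linarith

/-- ★ **The fixed-cut-off rung of (ULS) with an explicit constant.**  At cut-off `K` (lattice `L_K = (F.P K).sitesPerDir 0`, coupling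
`β'_K = (γε_K)⁻¹/2`), for every `C³` function `f` of the link coordinates (`F = f∘coords`):
`c_K·ε_K·(∫ F² log F² dμ_K − (∫ F² dμ_K) log(∫ F² dμ_K)) ≤ −∫ F 𝓛_K f dμ_K` with the EXPLICIT physical constant
`c_K = (1/2)e^{−|β'_K|·4·#𝒫_K}/ε_K` (`wilson_generatorLogSobolev_explicit`; worthless uniformly in `K`).
[cite: HolleyStroock1987] [cite: BakryGentilLedoux2014, Prop. 5.1.6 and Prop. 5.7.1] -/
theorem uniformLogSobolev_fixedCutoff_explicit (F : T3ContinuumYM3Torus.T3Family) (γ : ℝ) (K : ℕ)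
    (f : (Edge 3 ((F.P K).sitesPerDir 0) × Fin 2 × Fin 2 × Bool → ℝ) → ℝ) (hf : ContDiff ℝ 3 f) :
    let coords : GaugeConfig 3 ((F.P K).sitesPerDir 0) (Matrix.specialUnitaryGroup (Fin 2) ℂ) →
        (Edge 3 ((F.P K).sitesPerDir 0) × Fin 2 × Fin 2 × Bool → ℝ) :=
      fun V q => (fun z : ℂ => if q.2.2.2 then z.im else z.re)
        ((fundamentalRep (Fin 2) (V q.1) : Matrix (Fin 2) (Fin 2) ℂ) q.2.1 q.2.2.1)
    let gen : GaugeConfig 3 ((F.P K).sitesPerDir 0) (Matrix.specialUnitaryGroup (Fin 2) ℂ) → ℝ := fun V =>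
      (∑ i : Edge 3 ((F.P K).sitesPerDir 0) × Fin 2 × Fin 2 × Bool, fderiv ℝ f (coords V) (Pi.single i 1) *
          (fun z : ℂ => if i.2.2.2 then z.im else z.re)
            ((latticeLangevinDynamics (fundamentalLatticeRep 2) ((γ * (F.P K).eps)⁻¹ / 2)).drift
              (matrixConfig (fundamentalRep (Fin 2)) V) i.1 i.2.1 i.2.2.1) +
      1 / 2 * ∑ i : Edge 3 ((F.P K).sitesPerDir 0) × Fin 2 × Fin 2 × Bool,
        ∑ j : Edge 3 ((F.P K).sitesPerDir 0) × Fin 2 × Fin 2 × Bool,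
        fderiv ℝ (fun z => fderiv ℝ f z (Pi.single i 1)) (coords V) (Pi.single j 1) *
          ∑ n : Edge 3 ((F.P K).sitesPerDir 0) × NoiseIdx 2,
            (if n.1 = i.1 then (fun z : ℂ => if i.2.2.2 then z.im else z.re)
              ((latticeLangevinDynamics (fundamentalLatticeRep 2) ((γ * (F.P K).eps)⁻¹ / 2)).noise
                (matrixConfig (fundamentalRep (Fin 2)) V) i.1 n.2 i.2.1 i.2.2.1) else 0) *
            (if n.1 = j.1 then (fun z : ℂ => if j.2.2.2 then z.im else z.re)
              ((latticeLangevinDynamics (fundamentalLatticeRep 2) ((γ * (F.P K).eps)⁻¹ / 2)).noise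
                (matrixConfig (fundamentalRep (Fin 2)) V) j.1 n.2 j.2.1 j.2.2.1) else 0))
    ((1 / 2 : ℝ) * Real.exp (-(|(γ * (F.P K).eps)⁻¹ / 2| * (4 * (Fintype.card (Plaquette 3 ((F.P K).sitesPerDir 0)) : ℝ)))) /
        (F.P K).eps) * (F.P K).eps *
        ((∫ V, f (coords V) ^ 2 * Real.log (f (coords V) ^ 2)
            ∂(wilsonMeasure (d := 3) (L := (F.P K).sitesPerDir 0) (fundamentalRep (Fin 2)) ((γ * (F.P K).eps)⁻¹ / 2))) -
          (∫ V, f (coords V) ^ 2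
            ∂(wilsonMeasure (d := 3) (L := (F.P K).sitesPerDir 0) (fundamentalRep (Fin 2)) ((γ * (F.P K).eps)⁻¹ / 2))) *
            Real.log (∫ V, f (coords V) ^ 2
              ∂(wilsonMeasure (d := 3) (L := (F.P K).sitesPerDir 0) (fundamentalRep (Fin 2)) ((γ * (F.P K).eps)⁻¹ / 2)))) ≤
      -∫ V, f (coords V) * gen V
        ∂(wilsonMeasure (d := 3) (L := (F.P K).sitesPerDir 0) (fundamentalRep (Fin 2)) ((γ * (F.P K).eps)⁻¹ / 2)) := by
  have hε : 0 < (F.P K).eps := (F.P K).eps_pos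
  have h := wilson_generatorLogSobolev_explicit ((F.P K).sitesPerDir 0) ((γ * (F.P K).eps)⁻¹ / 2) f hf
  have e : (1 / 2 : ℝ) * Real.exp (-(|(γ * (F.P K).eps)⁻¹ / 2| * (4 * (Fintype.card (Plaquette 3 ((F.P K).sitesPerDir 0)) : ℝ)))) /
      (F.P K).eps * (F.P K).eps =
      (1 / 2 : ℝ) * Real.exp (-(|(γ * (F.P K).eps)⁻¹ / 2| * (4 * (Fintype.card (Plaquette 3 ((F.P K).sitesPerDir 0)) : ℝ)))) :=
    div_mul_cancel₀ _ hε.ne'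
  rw [e]
  exact h

/-- ★ **No physical log-Sobolev constant of (ULS) at a fixed cut-off exceeds `3/(4ε_K)`** (`L_K ≥ 2`): if at cut-off `K` the Wilson measure
`μ_K` satisfies `c·ε_K·Ent_{μ_K}(F²) ≤ −∫ F 𝓛_K f dμ_K` for all `C³` cylinders, then `c ≤ 3/(4ε_K)` — the gauge modes
(`logSobolev_const_le_three_quarters`).  No obstruction to (ULS): the bound diverges as `ε_K → 0`. [folklore] -/
theorem physicalLogSobolevRate_le_fixedCutoff (F : T3ContinuumYM3Torus.T3Family) (γ : ℝ) (K : ℕ) (hL : 2 ≤ (F.P K).sitesPerDir 0)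
    {c : ℝ}
    (hLS : ∀ (f : (Edge 3 ((F.P K).sitesPerDir 0) × Fin 2 × Fin 2 × Bool → ℝ) → ℝ), ContDiff ℝ 3 f →
        let coords : GaugeConfig 3 ((F.P K).sitesPerDir 0) (Matrix.specialUnitaryGroup (Fin 2) ℂ) →
            (Edge 3 ((F.P K).sitesPerDir 0) × Fin 2 × Fin 2 × Bool → ℝ) :=
          fun V q => (fun z : ℂ => if q.2.2.2 then z.im else z.re)
            ((fundamentalRep (Fin 2) (V q.1) : Matrix (Fin 2) (Fin 2) ℂ) q.2.1 q.2.2.1)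
        let gen : GaugeConfig 3 ((F.P K).sitesPerDir 0) (Matrix.specialUnitaryGroup (Fin 2) ℂ) → ℝ := fun V =>
          (∑ i : Edge 3 ((F.P K).sitesPerDir 0) × Fin 2 × Fin 2 × Bool, fderiv ℝ f (coords V) (Pi.single i 1) *
              (fun z : ℂ => if i.2.2.2 then z.im else z.re)
                ((latticeLangevinDynamics (fundamentalLatticeRep 2) ((γ * (F.P K).eps)⁻¹ / 2)).drift
                  (matrixConfig (fundamentalRep (Fin 2)) V) i.1 i.2.1 i.2.2.1) +
          1 / 2 * ∑ i : Edge 3 ((F.P K).sitesPerDir 0) × Fin 2 × Fin 2 × Bool,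
            ∑ j : Edge 3 ((F.P K).sitesPerDir 0) × Fin 2 × Fin 2 × Bool,
            fderiv ℝ (fun z => fderiv ℝ f z (Pi.single i 1)) (coords V) (Pi.single j 1) *
              ∑ n : Edge 3 ((F.P K).sitesPerDir 0) × NoiseIdx 2,
                (if n.1 = i.1 then (fun z : ℂ => if i.2.2.2 then z.im else z.re)
                  ((latticeLangevinDynamics (fundamentalLatticeRep 2) ((γ * (F.P K).eps)⁻¹ / 2)).noise
                    (matrixConfig (fundamentalRep (Fin 2)) V) i.1 n.2 i.2.1 i.2.2.1) else 0) *
                (if n.1 = j.1 then (fun z : ℂ => if j.2.2.2 then z.im else z.re)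
                  ((latticeLangevinDynamics (fundamentalLatticeRep 2) ((γ * (F.P K).eps)⁻¹ / 2)).noise
                    (matrixConfig (fundamentalRep (Fin 2)) V) j.1 n.2 j.2.1 j.2.2.1) else 0))
        c * (F.P K).eps *
            ((∫ V, f (coords V) ^ 2 * Real.log (f (coords V) ^ 2)
                ∂(wilsonMeasure (d := 3) (L := (F.P K).sitesPerDir 0) (fundamentalRep (Fin 2)) ((γ * (F.P K).eps)⁻¹ / 2))) -
              (∫ V, f (coords V) ^ 2
                ∂(wilsonMeasure (d := 3) (L := (F.P K).sitesPerDir 0) (fundamentalRep (Fin 2)) ((γ * (F.P K).eps)⁻¹ / 2))) *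
                Real.log (∫ V, f (coords V) ^ 2
                  ∂(wilsonMeasure (d := 3) (L := (F.P K).sitesPerDir 0) (fundamentalRep (Fin 2)) ((γ * (F.P K).eps)⁻¹ / 2)))) ≤
          -∫ V, f (coords V) * gen V
            ∂(wilsonMeasure (d := 3) (L := (F.P K).sitesPerDir 0) (fundamentalRep (Fin 2)) ((γ * (F.P K).eps)⁻¹ / 2))) :
    c ≤ 3 / (4 * (F.P K).eps) := by
  have hε : 0 < (F.P K).eps := (F.P K).eps_pos
  have h := logSobolev_const_le_three_quarters ((F.P K).sitesPerDir 0) hL ((γ * (F.P K).eps)⁻¹ / 2) (ρ := c * (F.P K).eps) hLS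
  rw [le_div_iff₀ (by positivity)]
  linarith

end Summit.QuantumFields.YangMills.Theorems.ColdStartUniversality

end
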